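import Literature.Analysis.FunctionSpaces.HolderAlgebra
import Literature.Analysis.FunctionSpaces.TorusHolderBridge
import Literature.Analysis.FunctionSpaces.TorusSobolevNormEmbeddingProofs
import HarnessLib

/-!
# Sobolev embedding into Hölder classes on `T^d`: discharge of `Torus.MemSobolev.memHolder_of_lt`

Discharge of the named fact `Literature.Analysis.FunctionSpaces.Torus.MemSobolev.memHolder_of_lt`
of `TorusSobolevNorm`: **if `f ∈ H^s(T^d; F)` (`F` a complex Banach space), `α ≤ 1` and
`d/2 + α < s`, then `f` has an `α`-Hölder continuous representative** (Bahouri–Chemin–Danchin 2011,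
Thm. 1.50, book p. 37: `Ḣ^s(ℝ^d) ⊂ C^{k,ρ}` for `s > d/2`, `s - d/2 ∉ ℕ`, `(k, ρ) = ([s - d/2],
s - d/2 - [s - d/2])`; the vendored statement is its non-sharp periodic form, `ρ` replaced by any
`α < s - d/2` with `α ≤ 1`). It complements the embedding into continuous functions
`Torus.MemSobolev.continuous_of_lt_holds` of `TorusSobolevNormEmbeddingProofs`, whose weighted
summability and Fourier-inversion lemmas are reused.

## The proof (BCD's Fourier-inversion argument, non-sharp form)

BCD prove Thm. 1.50 by Fourier inversion and the Cauchy–Schwarz inequality (low frequencies are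
Lipschitz with constant `∫ |ξ| |û|`, high frequencies are bounded by `∫ |û|`, then the cut-off is
optimised). On `T^d` and for a *strict* exponent `α < s - d/2` no frequency cut-off is needed:

1. *Weighted `ℓ¹` bound* (`Torus.MemSobolev.summable_sobolevWeight_mul_norm_mFourierCoeff`):
   `∑_k ⟨k⟩^α ‖f̂(k)‖ < ∞`, from `2 ⟨k⟩^α ‖f̂(k)‖ = 2 ⟨k⟩^{α-s} · ⟨k⟩^s ‖f̂(k)‖ ≤
   ⟨k⟩^{2(α-s)} + ⟨k⟩^{2s} ‖f̂(k)‖²` and the lattice `p`-series `∑_k (1 + |k|²)^{-(s-α)} < ∞`,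
   valid exactly when `2(s - α) > d` (`Torus.summable_one_add_freqNormSq_rpow_neg_of_lt`).
2. *The representative* `g = Torus.fourierSynth f̂ = ∑_k e_k f̂(k)` (absolutely convergent Fourier
   series): `g = f` a.e. by Fourier inversion in `A(T^d)` (`Torus.ae_eq_fourierSynth_mFourierCoeff`,
   Grafakos 2014, Prop. 3.2.4–3.2.5).
3. *Hölder bound.* The characters satisfy the chord estimate
   `‖e_k(x) - e_k(y)‖ ≤ min (2, 2π |k|₁ dist(x, y)) ≤ 2^{1-α} (2π d ⟨k⟩ dist(x, y))^α`
   (`Torus.norm_mFourier_sub_mFourier_le`, `Torus.norm_mFourier_sub_mFourier_le_rpow`; good lifts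
   `UnitAddCircle.exists_lift_abs_sub_eq_dist` of `TorusHolderBridge` and Mathlib's
   `Real.norm_exp_I_mul_ofReal_sub_one_le`), whence
   `‖g(x) - g(y)‖ ≤ 2^{1-α} (2π d)^α (∑_k ⟨k⟩^α ‖f̂(k)‖) dist(x, y)^α`
   (`Torus.norm_fourierSynth_sub_fourierSynth_le`, `Torus.memHolder_fourierSynth`).

Everything is proved; no definitions and no new named facts are introduced.

## Mathlib / tree search

Mathlib (this pin) has Hölder classes (`HolderWith`, `MemHolder`) and the chord estimate
`Real.norm_exp_I_mul_ofReal_sub_one_le`, but no modulus-of-continuity lemma for `fourier` /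
`UnitAddTorus.mFourier` (searched `norm_fourier_sub`, `fourier_sub_fourier`, `lipschitzWith_fourier`,
`dist (fourier`: only the derivative `hasDerivAt_fourier`) and no Sobolev scale on the torus. The tree has the converse embedding `C^{0,r} ⊂ H^s`, `s < r`
(`TorusHolderSobolevEmbedding`) and, since `TorusSobolevNormEmbeddingProofs`, `H^s ⊂ A(T^d) ⊂ C`
for `s > d/2`; the weighted bound and the Hölder modulus of Fourier series are new.

## References

* H. Bahouri, J.-Y. Chemin, R. Danchin, *Fourier Analysis and Nonlinear Partial Differential
  Equations*, Grundlehren 343 (Springer 2011), Def. 1.49 and Thm. 1.50 with its proof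
  (book pp. 37–38). [BahouriCheminDanchinGL343]
* L. Grafakos, *Classical Fourier Analysis*, 3rd ed., GTM 249 (Springer 2014), Prop. 3.2.4,
  Prop. 3.2.5, §3.3.3. [Grafakos2014]
-/

open MeasureTheory Set Filter Topology UnitAddTorus
open scoped ENNReal NNReal

noncomputable section

namespace Literature.Analysis.FunctionSpaces

namespace Torus

variable {d : Type*} [Fintype d]

/-! ## Chord estimates for the characters -/

section Chord

/-- Telescoping: `‖∏ aᵢ - ∏ bᵢ‖ ≤ ∑ ‖aᵢ - bᵢ‖` when all `‖aᵢ‖, ‖bᵢ‖ ≤ 1`. [folklore] -/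
theorem norm_finsetProd_sub_finsetProd_le {ι : Type*} (s : Finset ι) {a b : ι → ℂ}
    (ha : ∀ i ∈ s, ‖a i‖ ≤ 1) (hb : ∀ i ∈ s, ‖b i‖ ≤ 1) :
    ‖∏ i ∈ s, a i - ∏ i ∈ s, b i‖ ≤ ∑ i ∈ s, ‖a i - b i‖ := by
  classical
  induction s using Finset.induction_on with
  | empty => simp
  | insert j s hj ih =>
    rw [Finset.prod_insert hj, Finset.prod_insert hj, Finset.sum_insert hj]
    have ha' : ∀ i ∈ s, ‖a i‖ ≤ 1 := fun i hi => ha i (Finset.mem_insert_of_mem hi)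
    have hb' : ∀ i ∈ s, ‖b i‖ ≤ 1 := fun i hi => hb i (Finset.mem_insert_of_mem hi)
    have hbj : ‖∏ i ∈ s, b i‖ ≤ 1 := by
      rw [norm_prod]
      exact Finset.prod_le_one (fun i _ => norm_nonneg _) hb'
    have h : a j * ∏ i ∈ s, a i - b j * ∏ i ∈ s, b i
        = a j * (∏ i ∈ s, a i - ∏ i ∈ s, b i) + (a j - b j) * ∏ i ∈ s, b i := by ring
    calc ‖a j * ∏ i ∈ s, a i - b j * ∏ i ∈ s, b i‖
        = ‖a j * (∏ i ∈ s, a i - ∏ i ∈ s, b i) + (a j - b j) * ∏ i ∈ s, b i‖ := by rw [h]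
      _ ≤ ‖a j * (∏ i ∈ s, a i - ∏ i ∈ s, b i)‖ + ‖(a j - b j) * ∏ i ∈ s, b i‖ := norm_add_le _ _
      _ ≤ 1 * ‖∏ i ∈ s, a i - ∏ i ∈ s, b i‖ + ‖a j - b j‖ * 1 := by
          rw [norm_mul, norm_mul]
          gcongr
          exact ha j (Finset.mem_insert_self j s)
      _ ≤ ‖a j - b j‖ + ∑ i ∈ s, ‖a i - b i‖ := by linarith [ih ha' hb']

/-- Chord estimate for pure exponentials: `‖e^{ip} - e^{iq}‖ ≤ |p - q|` (`e^{ip} - e^{iq} =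
e^{iq} (e^{i(p-q)} - 1)` and Mathlib's `Real.norm_exp_I_mul_ofReal_sub_one_le`). [folklore] -/
theorem norm_cexp_I_mul_sub_cexp_I_mul_le (p q : ℝ) :
    ‖Complex.exp (Complex.I * p) - Complex.exp (Complex.I * q)‖ ≤ |p - q| := by
  have h : Complex.exp (Complex.I * p) =
      Complex.exp ((q : ℂ) * Complex.I) * Complex.exp (Complex.I * ((p - q : ℝ) : ℂ)) := by
    rw [← Complex.exp_add]
    congr 1
    push_cast
    ring
  have hq : Complex.exp (Complex.I * q) = Complex.exp ((q : ℂ) * Complex.I) := by rw [mul_comm]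
  rw [h, hq, ← mul_sub_one, norm_mul, Complex.norm_exp_ofReal_mul_I, one_mul]
  exact Real.norm_exp_I_mul_ofReal_sub_one_le.trans (le_of_eq (Real.norm_eq_abs _))

/-- **Chord estimate on the circle**: `‖e_n(u) - e_n(v)‖ ≤ 2π |n| dist(u, v)` for the characters
`e_n(x) = e^{2πi n x}` of `ℝ/ℤ` (good lifts `|a - b| = dist(u, v)`,
`UnitAddCircle.exists_lift_abs_sub_eq_dist`). [folklore] -/
theorem norm_fourier_sub_fourier_le (n : ℤ) (u v : UnitAddCircle) :
    ‖fourier n u - fourier n v‖ ≤ 2 * Real.pi * |(n : ℝ)| * dist u v := by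
  obtain ⟨a, b, rfl, rfl, hab⟩ := UnitAddCircle.exists_lift_abs_sub_eq_dist u v
  rw [← hab, fourier_coe_apply, fourier_coe_apply]
  have ha : Complex.exp (2 * Real.pi * Complex.I * n * a / (1 : ℝ)) =
      Complex.exp (Complex.I * ((2 * Real.pi * n * a : ℝ) : ℂ)) := by
    congr 1
    push_cast
    ring
  have hb : Complex.exp (2 * Real.pi * Complex.I * n * b / (1 : ℝ)) =
      Complex.exp (Complex.I * ((2 * Real.pi * n * b : ℝ) : ℂ)) := by
    congr 1
    push_cast
    ring
  rw [ha, hb]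
  refine (norm_cexp_I_mul_sub_cexp_I_mul_le _ _).trans (le_of_eq ?_)
  rw [← mul_sub, abs_mul, abs_mul, abs_of_pos Real.two_pi_pos]

/-- **Chord estimate on the torus**: `‖e_k(x) - e_k(y)‖ ≤ 2π |k|₁ dist(x, y)` for the characters
`e_k = ∏ᵢ e_{kᵢ}(xᵢ)` of `T^d` (telescoping over the coordinates, `dist(xᵢ, yᵢ) ≤ dist(x, y)` for
the product metric). [folklore] -/
theorem norm_mFourier_sub_mFourier_le (k : d → ℤ) (x y : UnitAddTorus d) :
    ‖mFourier k x - mFourier k y‖ ≤ 2 * Real.pi * (∑ i, |(k i : ℝ)|) * dist x y := by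
  change ‖(∏ i, fourier (k i) (x i)) - ∏ i, fourier (k i) (y i)‖ ≤ _
  have h1 : ∀ (m : ℤ) (u : UnitAddCircle), ‖fourier m u‖ ≤ 1 := fun m u => by
    rw [fourier_apply, Circle.norm_coe]
  refine (norm_finsetProd_sub_finsetProd_le _ (fun i _ => h1 _ _) (fun i _ => h1 _ _)).trans ?_
  calc ∑ i, ‖fourier (k i) (x i) - fourier (k i) (y i)‖
      ≤ ∑ i, 2 * Real.pi * |(k i : ℝ)| * dist x y := Finset.sum_le_sum fun i _ =>
          (norm_fourier_sub_fourier_le (k i) (x i) (y i)).trans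
            (mul_le_mul_of_nonneg_left (dist_le_pi_dist x y i) (by positivity))
    _ = 2 * Real.pi * (∑ i, |(k i : ℝ)|) * dist x y := by
          rw [Finset.mul_sum, Finset.sum_mul]

/-- The trivial bound `‖e_k(x) - e_k(y)‖ ≤ 2`. [folklore] -/
theorem norm_mFourier_sub_mFourier_le_two (k : d → ℤ) (x y : UnitAddTorus d) :
    ‖mFourier k x - mFourier k y‖ ≤ 2 :=
  (norm_sub_le _ _).trans (by rw [norm_mFourier_apply, norm_mFourier_apply]; norm_num)

/-- `|k|₁ ≤ d ⟨k⟩`: each `|kᵢ| ≤ (1 + |k|²)^{1/2} = ⟨k⟩`. [folklore] -/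
theorem sum_abs_le_card_mul_sobolevWeight_one (k : d → ℤ) :
    ∑ i, |(k i : ℝ)| ≤ Fintype.card d * sobolevWeight 1 k := by
  have h : ∀ i, |(k i : ℝ)| ≤ sobolevWeight 1 k := fun i => by
    rw [sobolevWeight, ← Real.sqrt_eq_rpow]
    refine Real.abs_le_sqrt ?_
    have : ((k i : ℝ)) ^ 2 ≤ freqNormSq k :=
      Finset.single_le_sum (f := fun j => ((k j : ℝ)) ^ 2) (fun j _ => sq_nonneg _)
        (Finset.mem_univ i)
    linarith
  calc ∑ i, |(k i : ℝ)| ≤ ∑ _i : d, sobolevWeight 1 k := Finset.sum_le_sum fun i _ => h i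
    _ = Fintype.card d * sobolevWeight 1 k := by
        rw [Finset.sum_const, Finset.card_univ, nsmul_eq_mul]

/-- Real interpolation between two upper bounds: `A ≤ a` and `A ≤ b` give `A ≤ a^{1-t} b^t` for
`0 ≤ t ≤ 1` (`A = A^{1-t} A^t`). [folklore] -/
theorem le_rpow_one_sub_mul_rpow_of_le_of_le {A a b t : ℝ} (hA : 0 ≤ A) (hAa : A ≤ a)
    (hAb : A ≤ b) (ht0 : 0 ≤ t) (ht1 : t ≤ 1) : A ≤ a ^ (1 - t) * b ^ t := by
  have h1 : (1 - t) + t ≠ 0 := by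
    rw [sub_add_cancel]
    exact one_ne_zero
  calc A = A ^ (1 - t) * A ^ t := by rw [← Real.rpow_add' hA h1, sub_add_cancel, Real.rpow_one]
    _ ≤ a ^ (1 - t) * b ^ t :=
        mul_le_mul (Real.rpow_le_rpow hA hAa (by linarith)) (Real.rpow_le_rpow hA hAb ht0)
          (Real.rpow_nonneg hA _) (Real.rpow_nonneg (hA.trans hAa) _)

/-- **Hölder modulus of the characters**: for `0 ≤ t ≤ 1`,
`‖e_k(x) - e_k(y)‖ ≤ 2^{1-t} (2π d)^t ⟨k⟩^t dist(x, y)^t`, interpolating between the trivial bound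
`2` and the Lipschitz bound `2π |k|₁ dist(x, y) ≤ 2π d ⟨k⟩ dist(x, y)` (the elementary estimate
behind the Hölder embedding, Bahouri–Chemin–Danchin 2011, proof of Thm. 1.50). [folklore] -/
theorem norm_mFourier_sub_mFourier_le_rpow {t : ℝ} (ht0 : 0 ≤ t) (ht1 : t ≤ 1) (k : d → ℤ)
    (x y : UnitAddTorus d) :
    ‖mFourier k x - mFourier k y‖ ≤
      2 ^ (1 - t) * (2 * Real.pi * Fintype.card d) ^ t * sobolevWeight t k * dist x y ^ t := by
  have hw0 : 0 ≤ sobolevWeight 1 k := (sobolevWeight_pos 1 k).le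
  have hc0 : (0 : ℝ) ≤ 2 * Real.pi * Fintype.card d := by positivity
  have hB : ‖mFourier k x - mFourier k y‖ ≤
      2 * Real.pi * Fintype.card d * sobolevWeight 1 k * dist x y := by
    refine (norm_mFourier_sub_mFourier_le k x y).trans ?_
    have h := sum_abs_le_card_mul_sobolevWeight_one k
    have hd : 0 ≤ dist x y := dist_nonneg
    calc 2 * Real.pi * (∑ i, |(k i : ℝ)|) * dist x y
        ≤ 2 * Real.pi * (Fintype.card d * sobolevWeight 1 k) * dist x y := by gcongr
      _ = 2 * Real.pi * Fintype.card d * sobolevWeight 1 k * dist x y := by ring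
  refine (le_rpow_one_sub_mul_rpow_of_le_of_le (norm_nonneg _)
    (norm_mFourier_sub_mFourier_le_two k x y) hB ht0 ht1).trans (le_of_eq ?_)
  rw [Real.mul_rpow (mul_nonneg hc0 hw0) dist_nonneg, Real.mul_rpow hc0 hw0]
  have hw : sobolevWeight 1 k ^ t = sobolevWeight t k := by
    rw [sobolevWeight, sobolevWeight, ← Real.rpow_mul (by linarith [freqNormSq_nonneg k])]
    congr 1
    ring
  rw [hw]
  ring

end Chord

/-! ## Summability of the weighted coefficients -/

section Summability

/-- The lattice `p`-series in Sobolev-weight form: `∑_k ⟨k⟩^{-2t} = ∑_k (1 + |k|²)^{-t} < ∞` for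
`2t > d` (`Torus.summable_one_add_freqNormSq_rpow_neg_of_lt`). [folklore] -/
theorem summable_sobolevWeight_neg_sq {t : ℝ} (ht : (Fintype.card d : ℝ) < 2 * t) :
    Summable fun k : d → ℤ => sobolevWeight (-t) k ^ 2 := by
  have hw : ∀ k : d → ℤ, sobolevWeight (-t) k ^ 2 = (1 + freqNormSq k) ^ (-t) := fun k => by
    rw [sobolevWeight, ← Real.rpow_natCast,
      ← Real.rpow_mul (by linarith [freqNormSq_nonneg k])]
    congr 1
    push_cast
    ring
  simp_rw [hw]
  exact summable_one_add_freqNormSq_rpow_neg_of_lt ht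

variable {F : Type*} [NormedAddCommGroup F] [NormedSpace ℂ F]

/-- **Weighted `ℓ¹` bound for `H^s` coefficients** (the Cauchy–Schwarz step of
Bahouri–Chemin–Danchin 2011, Thm. 1.50, on `T^d`): if `f ∈ H^s(T^d; F)` and `d/2 + α < s`, then
`∑_k ⟨k⟩^α ‖f̂(k)‖ < ∞`. Proof: `2 ⟨k⟩^α ‖f̂(k)‖ = 2 ⟨k⟩^{α-s} · ⟨k⟩^s ‖f̂(k)‖ ≤ ⟨k⟩^{2(α-s)} +
⟨k⟩^{2s} ‖f̂(k)‖²`, and both majorants are summable (`2(s - α) > d`,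
`Torus.summable_sobolevWeight_neg_sq` and `Torus.MemSobolev.summable_sobolevWeight_sq_mul_norm_sq`).
The case `α = 0` is `Torus.MemSobolev.summable_norm_mFourierCoeff`.
[cite: BahouriCheminDanchinGL343, Thm. 1.50 (proof, Cauchy–Schwarz step; ℝ^d, adapted to 𝐓^d)] -/
theorem MemSobolev.summable_sobolevWeight_mul_norm_mFourierCoeff {s α : ℝ}
    {f : UnitAddTorus d → F} (hf : MemSobolev s f) (hs : (Fintype.card d : ℝ) / 2 + α < s) :
    Summable fun k => sobolevWeight α k * ‖mFourierCoeff f k‖ := by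
  have hsα : (Fintype.card d : ℝ) < 2 * (s - α) := by linarith
  have hA := summable_sobolevWeight_neg_sq (d := d) hsα
  have hB := hf.summable_sobolevWeight_sq_mul_norm_sq
  refine Summable.of_nonneg_of_le (fun k => mul_nonneg (sobolevWeight_pos _ _).le (norm_nonneg _))
    (fun k => ?_) ((hA.add hB).div_const 2)
  have hw : sobolevWeight α k = sobolevWeight (-(s - α)) k * sobolevWeight s k := by
    rw [sobolevWeight, sobolevWeight, sobolevWeight,
      ← Real.rpow_add (by linarith [freqNormSq_nonneg k])]
    congr 1
    ring
  have h2 :=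
    two_mul_le_add_sq (sobolevWeight (-(s - α)) k) (sobolevWeight s k * ‖mFourierCoeff f k‖)
  rw [mul_pow] at h2
  rw [hw, mul_assoc]
  linarith

omit [NormedSpace ℂ F] in
/-- A family with `∑_k ⟨k⟩^t ‖c k‖ < ∞` for some `t ≥ 0` is absolutely summable (`⟨k⟩^t ≥ 1`).
[folklore] -/
theorem summable_norm_of_summable_sobolevWeight_mul_norm {c : (d → ℤ) → F} {t : ℝ} (ht : 0 ≤ t)
    (hc : Summable fun k => sobolevWeight t k * ‖c k‖) : Summable fun k => ‖c k‖ :=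
  Summable.of_nonneg_of_le (fun k => norm_nonneg _)
    (fun k => le_mul_of_one_le_left (norm_nonneg _)
      (Real.one_le_rpow (by linarith [freqNormSq_nonneg k]) (by linarith)))
    hc

end Summability

/-! ## Hölder modulus of absolutely convergent Fourier series, and the embedding -/

section Embedding

variable {F : Type*} [NormedAddCommGroup F] [NormedSpace ℂ F] [CompleteSpace F]

/-- **Hölder bound for absolutely convergent Fourier series**: if `∑_k ⟨k⟩^t ‖c k‖ < ∞` with
`0 ≤ t ≤ 1`, the synthesis `F_c(x) = ∑_k e_k(x) c_k` (`Torus.fourierSynth c`) satisfies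
`‖F_c(x) - F_c(y)‖ ≤ 2^{1-t} (2π d)^t (∑_k ⟨k⟩^t ‖c k‖) dist(x, y)^t` (termwise chord estimate
`Torus.norm_mFourier_sub_mFourier_le_rpow`). [folklore] -/
theorem norm_fourierSynth_sub_fourierSynth_le {c : (d → ℤ) → F} {t : ℝ} (ht0 : 0 ≤ t)
    (ht1 : t ≤ 1) (hc : Summable fun k => sobolevWeight t k * ‖c k‖) (x y : UnitAddTorus d) :
    ‖fourierSynth c x - fourierSynth c y‖ ≤
      2 ^ (1 - t) * (2 * Real.pi * Fintype.card d) ^ t * (∑' k, sobolevWeight t k * ‖c k‖) *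
        dist x y ^ t := by
  have h1 : Summable fun k => ‖c k‖ := summable_norm_of_summable_sobolevWeight_mul_norm ht0 hc
  set K : ℝ := 2 ^ (1 - t) * (2 * Real.pi * Fintype.card d) ^ t with hK
  have hsub : HasSum (fun k => mFourier k x • c k - mFourier k y • c k)
      (fourierSynth c x - fourierSynth c y) :=
    (hasSum_mFourier_smul h1 x).sub (hasSum_mFourier_smul h1 y)
  have hmaj : HasSum (fun k => K * dist x y ^ t * (sobolevWeight t k * ‖c k‖))
      (K * dist x y ^ t * ∑' k, sobolevWeight t k * ‖c k‖) :=
    hc.hasSum.mul_left _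
  have hle := hsub.norm_le_of_bounded hmaj fun k => by
    rw [← sub_smul, norm_smul]
    calc ‖mFourier k x - mFourier k y‖ * ‖c k‖
        ≤ (K * sobolevWeight t k * dist x y ^ t) * ‖c k‖ :=
          mul_le_mul_of_nonneg_right (by
            rw [hK]
            exact norm_mFourier_sub_mFourier_le_rpow ht0 ht1 k x y) (norm_nonneg _)
      _ = K * dist x y ^ t * (sobolevWeight t k * ‖c k‖) := by ring
  calc ‖fourierSynth c x - fourierSynth c y‖
      ≤ K * dist x y ^ t * ∑' k, sobolevWeight t k * ‖c k‖ := hle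
    _ = K * (∑' k, sobolevWeight t k * ‖c k‖) * dist x y ^ t := by ring

/-- **Absolutely convergent Fourier series with `∑_k ⟨k⟩^α ‖c k‖ < ∞` are `α`-Hölder**
(`α ≤ 1`): `Torus.fourierSynth c ∈ C^{0,α}(T^d; F)` with constant
`2^{1-α} (2π d)^α ∑_k ⟨k⟩^α ‖c k‖`. [folklore] -/
theorem memHolder_fourierSynth {c : (d → ℤ) → F} {α : ℝ≥0} (hα : α ≤ 1)
    (hc : Summable fun k => sobolevWeight α k * ‖c k‖) : MemHolder α (fourierSynth c) := by
  set S : ℝ := ∑' k, sobolevWeight α k * ‖c k‖ with hS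
  set K : ℝ := 2 ^ (1 - (α : ℝ)) * (2 * Real.pi * Fintype.card d) ^ (α : ℝ) with hK
  have hKS : 0 ≤ K * S :=
    mul_nonneg (by positivity)
      (tsum_nonneg fun k => mul_nonneg (sobolevWeight_pos _ _).le (norm_nonneg _))
  refine ⟨(K * S).toNNReal, holderWith_of_dist_le fun x y => ?_⟩
  rw [Real.coe_toNNReal _ hKS, dist_eq_norm]
  exact norm_fourierSynth_sub_fourierSynth_le α.coe_nonneg (by exact_mod_cast hα) hc x y

/-- **Sobolev embedding `H^s(T^d) ⊂ C^{0,α}(T^d)` for `d/2 + α < s`, `α ≤ 1`**: `f ∈ H^s(T^d; F)`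
agrees a.e. with the `α`-Hölder continuous sum `Torus.fourierSynth f̂ = ∑_k e_k f̂(k)` of its
Fourier series (Bahouri–Chemin–Danchin 2011, Thm. 1.50 in its non-sharp periodic form: weighted
`ℓ¹` bound `MemSobolev.summable_sobolevWeight_mul_norm_mFourierCoeff`, Hölder modulus
`memHolder_fourierSynth`, Fourier inversion in `A(T^d)` `ae_eq_fourierSynth_mFourierCoeff`).
[cite: BahouriCheminDanchinGL343, Thm. 1.50 (ℝ^d; adapted to 𝐓^d)] -/
theorem MemSobolev.ae_eq_fourierSynth_and_memHolder {s : ℝ} {α : ℝ≥0} {f : UnitAddTorus d → F}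
    (hf : MemSobolev s f) (hα : α ≤ 1) (hs : (Fintype.card d : ℝ) / 2 + α < s) :
    f =ᵐ[volume] fourierSynth (mFourierCoeff f) ∧ MemHolder α (fourierSynth (mFourierCoeff f)) := by
  have hS := hf.summable_sobolevWeight_mul_norm_mFourierCoeff hs
  exact ⟨ae_eq_fourierSynth_mFourierCoeff hf.integrable
    (summable_norm_of_summable_sobolevWeight_mul_norm α.coe_nonneg hS), memHolder_fourierSynth hα hS⟩

/-- Discharge of the named fact `Torus.MemSobolev.memHolder_of_lt`: **Sobolev embedding into
Hölder classes on `T^d`** — if `f ∈ H^s(T^d; F)` (`F` a complex Banach space), `α ≤ 1` and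
`d/2 + α < s`, then `f` has an `α`-Hölder continuous a.e. representative (Bahouri–Chemin–Danchin
2011, Thm. 1.50, book p. 37, `Ḣ^s(ℝ^d) ⊂ C^{k,ρ}`, in its non-sharp periodic form;
`MemSobolev.ae_eq_fourierSynth_and_memHolder`).
[cite: BahouriCheminDanchinGL343, Thm. 1.50 (ℝ^d; adapted to 𝐓^d)] -/
theorem MemSobolev.memHolder_of_lt_holds : MemSobolev.memHolder_of_lt (d := d) (F := F) := by
  intro s α f hf hα hs
  obtain ⟨hae, hH⟩ := hf.ae_eq_fourierSynth_and_memHolder hα hs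
  exact ⟨fourierSynth (mFourierCoeff f), hae.symm, hH⟩

end Embedding

end Torus

end Literature.Analysis.FunctionSpaces
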